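import Summits.BirchSwinnertonDyer.BirchSwinnertonDyer.Theorems.PrintCFramAnticyclotomicDescentThreeDefs
import Summits.BirchSwinnertonDyer.BirchSwinnertonDyer.Theses.PrintCFram
import Summits.BirchSwinnertonDyer.BirchSwinnertonDyer.Theorems.PrintCFramZpThreeSplit
import HarnessLib

/-!
# Item `EllipticUnitIMCThree` (stmt-BirchSwinnertonDyer-21353) at route level = Johnson-Leung–Kings
# 2011 Thm. 5.2 (§5.4 form) for `η_E` at `3` (REFEREED, applied in the kernel) ∧ ONE named lemma
# `AnticyclotomicSpecialisationThree` (cell `bsd-print-cfram`, D-0131 (2) PRINT tier, prover seat p1 as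
# fallback owner of the line «`EllipticUnitIMCThree` from JLK11 Thm 5.2», PLAN v4 §2; `--supports`
# stmt-BirchSwinnertonDyer-21353)

Companion of `PrintCFramAnticyclotomicDescentThreeDefs.lean` (the `@[conjecture]` lemma
`AnticyclotomicSpecialisationAtZpThree W` / slice form `AnticyclotomicSpecialisationThree`; nothing
asserted there or here). This file states the consequences AGAINST THE ROUTE DECL (rev ≥ 14):

* `anticyclotomicSpecialisationThree_of_ellipticUnitIMCThree` — the item ⟹ the lemma (a weakening);
* `ellipticUnitIMCThree_of_sec54_of_specialisation` — the named fact
  `JohnsonLeungKings2011.sec54_charIdeal_classGroup_eq_unitIndex` ∧ the lemma ⟹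
  `Theses.PrintCFram.EllipticUnitIMCThree` (the planner's `ellipticUnitIMCThree_of_JLK52_of_integralGap`
  shape: JLK52@3 BY NAME through `η_E` at `3`, files `PrintCFramResidualCharacterAtThree` /
  `PrintCFramJLKIdentityForEAtThree`; the «integral gap» = the ONE lemma);
* `ellipticUnitIMCThree_iff_specialisationThree_of_sec54` — GRANTED JLK's fact, the item ⟺ the lemma:
  the residual of (IMC)₃ᴺ beyond the refereed input is EXACTLY this one `Prop`;
* `torsionFreeFrameBSDThree_of_sec54_of_specialisation_of_indexLawThree` and
  `cmRamifiedThreeBSD_of_sec54_of_specialisation` — the registered line «zpthree» with the item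
  replaced by its two sources: regime N (`TorsionFreeFrameBSDThree`) from `h54` ∧ the lemma ∧ r4
  `BottomClassIndexLawThree`, and the `p = 3` crux C1 `CMRamifiedThreeBSD` from those ∧ T ∧ V, via the
  landed seams of `Theorems/PrintCFramZpThreeSplit.lean` (p3) — a DISPLAY of what C1 costs in by-name
  currency: one refereed input by name (JLK Thm. 5.2 / §5.4 for `η_E`), one descent lemma (this), one
  beyond-print value law (r4), and the two non-N regimes T, V.

CONDITIONAL results (hypotheses displayed); nothing asserted; item 21353, regime N, C1 and the leaf
stay OPEN. The named fact `h54` travels WITH ITS READING FLAG `JLK11-sec54-Rubin-modules` (REF A61: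
JLK §5.4's displayed isomorphism + printed comparisons; Burungale–Flach 2024 Rem. 7 gives the
equivalence with Rubin's formulation in words only for `p ∤ #𝒪_K^× · #G^tor` — never read `h54` as
«JLK prove Rubin 4.1 (ii) at 3»). «beyond-print theorem»: NO.

References: [JohnsonLeungKings2011] J. reine angew. Math. 653 (2011) Thm. 5.2, §5.4 (arXiv:0804.2828
p0014–p0016); [BurungaleKobayashiNakamuraOta2026] arXiv:2608.06879v1 Prop. 3.9 (2), Props. 3.12–3.13,
Thm. 3.14 (pp. 20–24) (claim; preprint).
-/

-- the summit namespace `Summit.BirchSwinnertonDyer.BirchSwinnertonDyer` repeats the problem name by design (D-0017)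
set_option linter.dupNamespace false

noncomputable section

open scoped Classical

open WeierstrassCurve Literature.NumberTheory.EllipticCurves Literature.NumberTheory.EllipticCurves.Rank1Residual
  Literature.NumberTheory.ComplexMultiplication.EllipticUnits.JohnsonLeungKings2011
  Summit.BirchSwinnertonDyer.Rank1Residual.X12.O11
  Summit.BirchSwinnertonDyer.BirchSwinnertonDyer.Theses.PrintCFram

namespace Summit.BirchSwinnertonDyer.BirchSwinnertonDyer.Theorems.PrintCFram.AnticyclotomicDescentThree

/-- **Item 21353 ⟹ the slice lemma** (the lemma is a weakening of the route item; typing it adds no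
strength). [cite: BurungaleKobayashiNakamuraOta2026, Thm. 3.14 (arXiv:2608.06879v1 p. 24) (claim; preprint; shape only)] -/
theorem anticyclotomicSpecialisationThree_of_ellipticUnitIMCThree (h : EllipticUnitIMCThree) :
    AnticyclotomicSpecialisationThree :=
  anticyclotomicSpecialisationThree_of_forall_imcAtZpThree h

/-- **[JohnsonLeungKings2011] Thm. 5.2 (§5.4 form, named fact) ∧ the slice lemma ⟹ item 21353
`EllipticUnitIMCThree`.** The refereed two-variable main conjecture at `3` ("for all primes `p` with
no exceptions"; §5.4: "no restriction on `p` besides … `p` prime to the order of `Δ`"), applied in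
the kernel to the residual character `η_E` of every member of the `p = 3` slice
(`JLKSetting.charIdeal_classGroup_eq_unitIndex_of_sec54_residualChar_of_isFrameThree`), composed with
the ONE named lemma. CONDITIONAL on both displayed hypotheses (`h54` with its reading flag
`JLK11-sec54-Rubin-modules`, REF A61).
[cite: JohnsonLeungKings2011, Thm. 5.2 and §5.4 (arXiv:0804.2828 p0014:L114–133, p0016:L19–26)]
[cite: BurungaleKobayashiNakamuraOta2026, Prop. 3.9 (2) and Thm. 3.14 (arXiv:2608.06879v1 pp. 20–24) (claim; preprint)] -/
theorem ellipticUnitIMCThree_of_sec54_of_specialisation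
    (h54 : sec54_charIdeal_classGroup_eq_unitIndex) (hspec : AnticyclotomicSpecialisationThree) :
    EllipticUnitIMCThree :=
  forall_imcAtZpThree_of_sec54_of_specialisationThree h54 hspec

/-- **GRANTED [JohnsonLeungKings2011] Thm. 5.2, item 21353 ⟺ the slice lemma**: (IMC)₃ᴺ is the
refereed identity for `η_E` at `3` (in the kernel) plus EXACTLY this one `Prop`.
[cite: JohnsonLeungKings2011, §5.4 (arXiv:0804.2828 p0016:L19–26)]
[cite: BurungaleKobayashiNakamuraOta2026, Thm. 3.14 (arXiv:2608.06879v1 p. 24) (claim; preprint)] -/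
theorem ellipticUnitIMCThree_iff_specialisationThree_of_sec54
    (h54 : sec54_charIdeal_classGroup_eq_unitIndex) :
    EllipticUnitIMCThree ↔ AnticyclotomicSpecialisationThree :=
  forall_imcAtZpThree_iff_specialisationThree_of_sec54 h54

/-- **Regime N from JLK (named fact) ∧ the descent lemma ∧ the value law r4**:
`TorsionFreeFrameBSDThree` (item 20698) via p3's landed seam
`PrintCfram.torsionFreeFrameBSDThree_of_imcThree_of_indexLawThree` with (IMC)₃ᴺ replaced by its two
sources. CONDITIONAL display; nothing closed.
[cite: JohnsonLeungKings2011, §5.4 (arXiv:0804.2828 p0016:L19–26)]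
[cite: BurungaleKobayashiNakamuraOta2026, Thm. 3.14 (arXiv:2608.06879v1 p. 24) (claim; preprint)] -/
theorem torsionFreeFrameBSDThree_of_sec54_of_specialisation_of_indexLawThree
    (h54 : sec54_charIdeal_classGroup_eq_unitIndex) (hspec : AnticyclotomicSpecialisationThree)
    (h2 : BottomClassIndexLawThree) : TorsionFreeFrameBSDThree :=
  Summit.BirchSwinnertonDyer.Rank1Residual.PrintCfram.torsionFreeFrameBSDThree_of_imcThree_of_indexLawThree
    (ellipticUnitIMCThree_of_sec54_of_specialisation h54 hspec) h2

/-- **The `p = 3` crux C1 `CMRamifiedThreeBSD` in by-name currency**: from JLK's named fact, the ONE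
descent lemma at `3`, the value law r4 `BottomClassIndexLawThree`, and the regimes T
`LocalThreeTorsionBSDThree`, V `SplitPlaceTorsionBSDThree` — the registered line «zpthree»
(`PrintCfram.cmRamifiedThreeBSD_of_zpThree`, p3) with item 21353 replaced by its two sources.
CONDITIONAL display; nothing closed. [cite: JohnsonLeungKings2011, §5.4 (arXiv:0804.2828 p0016:L19–26)]
[cite: BurungaleKobayashiNakamuraOta2026, Thm. 3.14 (arXiv:2608.06879v1 p. 24) (claim; preprint)] -/
theorem cmRamifiedThreeBSD_of_sec54_of_specialisation
    (h54 : sec54_charIdeal_classGroup_eq_unitIndex) (hspec : AnticyclotomicSpecialisationThree)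
    (h2 : BottomClassIndexLawThree) (h3 : LocalThreeTorsionBSDThree) (h4 : SplitPlaceTorsionBSDThree) :
    CMRamifiedThreeBSD :=
  Summit.BirchSwinnertonDyer.Rank1Residual.PrintCfram.cmRamifiedThreeBSD_of_zpThree
    (ellipticUnitIMCThree_of_sec54_of_specialisation h54 hspec) h2 h3 h4

end Summit.BirchSwinnertonDyer.BirchSwinnertonDyer.Theorems.PrintCFram.AnticyclotomicDescentThree

end
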